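import Summits.Langlands.Langlands.Theorems.PicardMuOrdinaryMuOrdinaryFamilyRTPointPlan
import Summits.Langlands.Langlands.Theorems.PicardMuOrdinaryMuOrdinaryFamilyRTEndgame

/-!
# The Picard point of line `free-seed-smooth-rt` (crux `MuOrdinaryFamilyRT`, stmt-Langlands-13757):
# `stub_point` from the leaves and the named facts `F1`, `F2`, `F3`

Helper file for the registered stub `stub_point : S.stub_point`.  PROVED here, unconditionally:

* `exists_model_of_leaves` — from `Leaf.modelCore`, `Leaf.modelBorel`, `threeUnique` (file
  `…PointPlan.lean`), `PicardBorelAt3` and `ResiduallyDistinguished`: a homomorphism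
  `ρ₀ : Γ_K → GL₃(𝒪₀)` of type `Δ(f, B, F, m)` (`IsTypeDelta`, over `A = 𝒪₀ = O₀ ι e` itself) with
  a distinguished `F` and the Picard Frobenius traces `j₀(tr ρ₀(Frob_𝔭)) = ι⁻¹ e(a_𝔭(f))`;
* `datum`, `isDeformation_datum_iff` — the ordinary polarized residual datum `𝒟(f, B, F, m)` of
  `OrdinaryPolarizedDeformationRing.lean` over `𝒪₀` with `k = 𝔽₃`, and the clause-by-clause
  identification `𝒟.IsDeformation π ρ ↔ IsTypeDelta f B F m 𝒪₀ π ρ`;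
* `stub_point_of_leaves` — `S.stub_point` from the five leaves and `F1 =
  ordinaryPolarizedDeformationRing_nonempty`, `F2 = exists_descent_of_trace_mem_of_isAbsIrreducible_residual`,
  `F3 = exists_conj_eq_of_trace_eq_of_isAbsIrreducible_residual`: `F1` gives the universal ring of
  `𝒟`, transported to `UniversalRing f B F m 𝒪₀`; the point `x` is the classifying map of `ρ₀`, and
  `x_trace` follows from strict equivalence (traces are class functions).
-/

-- `Summit.Langlands.Langlands.…` (summit = sub-problem name, D-0017 layout) trips `dupNamespace` on every decl.
set_option linter.dupNamespace false

namespace Summit.Langlands.Langlands.Cruxes.MuOrdinaryFamilyRT.FreeSeedSmoothRt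

open scoped NumberField Polynomial Matrix Classical
open Field IsDedekindDomain Polynomial IsLocalRing
open Literature.NumberTheory.GaloisRepresentations

noncomputable section

/-! ### The model: glueing the leaves `modelCore`, `modelBorel` -/

section Model

variable {ι : PadicAlgCl 3 ≃+* ℂ} {e : K →+* ℂ}

/-- Traces are conjugation invariant and compatible with `GL_n(φ)`. -/
theorem trace_conj_map {A C : Type*} [CommRing A] [CommRing C] {n : Type*} [Fintype n] [DecidableEq n]
    (φ : A →+* C) (P : GL n C) (g : GL n A) :
    (P * Matrix.GeneralLinearGroup.map φ g * P⁻¹).val.trace = φ g.val.trace := by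
  rw [Units.val_mul, Units.val_mul, Matrix.trace_units_conj]
  change (g.val.map φ).trace = _
  rw [← AddMonoidHom.map_trace]

/-- **THE MODEL** from the leaves: for generic `f` in the scope, a type-`Δ(f, B, F, m)` lift `ρ₀`
of `r̄_f^B` over `𝒪₀` with a distinguished `F` and the Picard Frobenius traces. -/
theorem exists_model_of_leaves (hcore : Leaf.modelCore) (hborel : Leaf.modelBorel)
    (f : ℤ[X]) (hgen : Generic f) (hB : PicardBorelAt3 f ι e) (hD : ResiduallyDistinguished f)
    (hF2 : exists_descent_of_trace_mem_of_isAbsIrreducible_residual)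
    (hF3 : exists_conj_eq_of_trace_eq_of_isAbsIrreducible_residual) :
    ∃ (B : Module.Basis (Fin 3) (ZMod 3) (Heart 3 (Roots f))) (F : GL (Fin 3) (ZMod 3)) (m : ℤ)
      (ρ₀ : absoluteGaloisGroup K →* GL (Fin 3) (O₀ ι e)),
      (∀ v : HeightOneSpectrum (𝓞 K), (3 : 𝓞 K) ∈ v.asIdeal → IsDistinguishedFlag f B v F) ∧
      IsTypeDelta f B F m (O₀ ι e) (algebraMap (O₀ ι e) (ZMod 3)) ρ₀ ∧
      ∀ 𝔭 ∉ badPrimes f, ∀ 𝔓 ∈ 𝔭.primesAbove, ∀ σ : absoluteGaloisGroup K,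
        IsArithFrobAt (𝓞 K) σ 𝔓 → j₀ ι e (ρ₀ σ).val.trace = picardC f ι e 𝔭 := by
  obtain ⟨ρ, m, h1, h2, hflag⟩ := hB
  obtain ⟨B, F₀, hF₀⟩ := hD
  obtain ⟨ρ₁, P, hconj, hred, hcont⟩ := hcore f ι e B hgen hF2 hF3 ρ h1
  -- traces of `ρ₁` are those of `ρ`
  have htr : ∀ σ, j₀ ι e (ρ₁ σ).val.trace = FramedRep.trace ρ σ := fun σ => by
    rw [FramedRep.trace, hconj σ, trace_conj_map]
  -- the frame at the (unique) prime above `3`, if any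
  have hframe : ∃ F : GL (Fin 3) (ZMod 3),
      (∀ v : HeightOneSpectrum (𝓞 K), (3 : 𝓞 K) ∈ v.asIdeal → IsDistinguishedFlag f B v F) ∧
      ∀ v : HeightOneSpectrum (𝓞 K), (3 : 𝓞 K) ∈ v.asIdeal →
        ∃ g : GL (Fin 3) (O₀ ι e), IsUpper3 (F⁻¹ * Matrix.GeneralLinearGroup.map (algebraMap (O₀ ι e) (ZMod 3)) g).val ∧
          ∀ τ, IsUpper3 (g⁻¹ * ρ₁ (absGaloisRestrict K (v.adicCompletion K) τ) * g).val := by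
    by_cases hv : ∃ v : HeightOneSpectrum (𝓞 K), (3 : 𝓞 K) ∈ v.asIdeal
    · obtain ⟨v, hv3⟩ := hv
      obtain ⟨g, hg⟩ := hflag v hv3
      have hup : ∃ g' : GL (Fin 3) (PadicAlgCl 3), ∀ τ,
          IsUpper3 (g'⁻¹ * Matrix.GeneralLinearGroup.map (j₀ ι e) (ρ₁ (absGaloisRestrict K (v.adicCompletion K) τ)) * g').val := by
        refine ⟨(g * P)⁻¹, fun τ => ?_⟩
        have hτ := fun i j (hij : j < i) => hg τ i j hij
        have heq : (g * P)⁻¹⁻¹ * Matrix.GeneralLinearGroup.map (j₀ ι e) (ρ₁ (absGaloisRestrict K (v.adicCompletion K) τ)) * (g * P)⁻¹ =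
            ((ρ.toLocal v).conj g) τ := by
          rw [FramedRep.conj_apply, FramedGaloisRep.toLocal_apply]
          change _ = g * (ρ (absGaloisRestrict K (v.adicCompletion K) τ) : GL (Fin 3) (PadicAlgCl 3)) * g⁻¹
          rw [hconj, inv_inv, mul_inv_rev]
          group
        rw [heq]
        exact ⟨hτ 1 0 (by decide), hτ 2 0 (by decide), hτ 2 1 (by decide)⟩
      obtain ⟨F, g', hFd, hFg', hg'⟩ := hborel f ι e B F₀ v hv3 (hF₀ v hv3) ρ₁ hred hup
      refine ⟨F, fun w hw => ?_, fun w hw => ?_⟩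
      · rw [← threeUnique v w hv3 hw]; exact hFd
      · rw [← threeUnique v w hv3 hw]; exact ⟨g', hFg', hg'⟩
    · simp only [not_exists] at hv
      exact ⟨1, fun v hv3 => absurd hv3 (hv v), fun v hv3 => absurd hv3 (hv v)⟩
  obtain ⟨F, hFd, hFg⟩ := hframe
  refine ⟨B, F, m, ρ₁, hFd, ⟨hcont, hred, ?_, hFg, ?_⟩, ?_⟩
  · -- unramified outside `S(f)`
    intro v hv 𝔓 h𝔓 σ hσ
    have h := (h1 v hv).1 𝔓 h𝔓 σ hσ
    have h' : (ρ σ : GL (Fin 3) (PadicAlgCl 3)) = 1 := h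
    rw [hconj σ, mul_inv_eq_one, mul_eq_left] at h'
    exact generalLinearGroup_map_injective (j₀ ι e) (j₀_injective ι e) (by rw [h', map_one])
  · -- polarized
    intro c _ σ
    apply j₀_injective ι e
    rw [map_mul, htr, htr, h2 c ‹_› σ, Algebra.algebraMap_self, RingHom.id_apply, j₀_algebraMap]
    congr 1
  · -- Frobenius traces
    intro 𝔭 h𝔭 𝔓 h𝔓 σ hσ
    rw [htr]
    exact (h1 𝔭 h𝔭).2 𝔓 h𝔓 σ hσ

end Model

/-! ### The datum `𝒟(f, B, F, m)` over `𝒪₀` and the assembly -/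

section Assembly

variable {ι : PadicAlgCl 3 ≃+* ℂ} {e : K →+* ℂ} (hunr : Leaf.rbarUnramified) (hpol : Leaf.rbarPolarized)
  (f : ℤ[X]) (hgen : Generic f)
  (B : Module.Basis (Fin 3) (ZMod 3) (Heart 3 (Roots f))) (F : GL (Fin 3) (ZMod 3)) (m : ℤ)
  (hdist : ∀ v : HeightOneSpectrum (𝓞 K), (3 : 𝓞 K) ∈ v.asIdeal → IsDistinguishedFlag f B v F)

/-- The ordinary polarized residual datum `𝒟(f, B, F, m)` over `𝒪₀`: `S = S(f)`, `r̄ = r̄_f^B`,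
frame `F` at `λ`, `Θ` = complex conjugations, multiplier `ε^m`. -/
def datum : OrdinaryPolarizedDatum ℚ K 3 3 (O₀ ι e) (ZMod 3) where
  residueMap_surjective := algebraMap_O₀_ZMod_surjective ι e
  S := badPrimes f
  S_finite := badPrimes_finite hgen
  mem_S_of_mem v hv := by
    by_contra h
    exact three_not_mem_of_not_mem_badPrimes h (by simpa using hv)
  residual := rbar f B
  isOpen_ker_residual := isOpen_ker_rbar f B
  residual_unramified := hunr f B hgen
  frame _ := F
  frame_spec v hv σ := (isUpper3_iff_blockTriangular _).mp ((hdist v (by simpa using hv)).1 σ)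
  Θ := {c | IsComplexConjugation (algebraMap ℚ ℝ) c}
  m := m
  residual_polarized c _ σ := hpol f B (O₀ ι e) m c σ

variable {hunr hpol f hgen B F m hdist}

/-- Deformations of type `𝒟(f, B, F, m)` are exactly the type-`Δ(f, B, F, m)` lifts. -/
theorem isDeformation_datum_iff {A : Type} [CommRing A] [IsLocalRing A] [Algebra (O₀ ι e) A]
    (π : A →ₐ[O₀ ι e] ZMod 3) (ρ : absoluteGaloisGroup K →* GL (Fin 3) A) :
    (datum hunr hpol f hgen B F m hdist).IsDeformation π ρ ↔ IsTypeDelta f B F m (O₀ ι e) (π : A →+* ZMod 3) ρ := by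
  unfold OrdinaryPolarizedDatum.IsDeformation IsTypeDelta
  refine and_congr Iff.rfl (and_congr ?_ (and_congr Iff.rfl (and_congr ?_ Iff.rfl)))
  · rw [MonoidHom.ext_iff]
    refine forall_congr' fun σ => ?_
    rw [MonoidHom.comp_apply, Units.ext_iff]
    rfl
  · refine forall_congr' fun v => ?_
    simp only [Nat.cast_ofNat, isUpper3_iff_blockTriangular]
    rfl

end Assembly

/-- **`stub_point` from the leaves and the three named facts** (`F1` = Mazur–Tilouine
representability `ordinaryPolarizedDeformationRing_nonempty`, `F2`, `F3` = Carayol–Serre). -/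
theorem stub_point_of_leaves : Leaf.rbarUnramified → Leaf.rbarPolarized → Leaf.rbarAbsIrreducible → Leaf.modelCore → Leaf.modelBorel → ordinaryPolarizedDeformationRing_nonempty → exists_descent_of_trace_mem_of_isAbsIrreducible_residual → exists_conj_eq_of_trace_eq_of_isAbsIrreducible_residual → S.stub_point := by
  intro hunr hpol hirr hcore hborel hF1 hF2 hF3 f ι e hgen hBorel hDist
  obtain ⟨B, F, m, ρ₀, hdist, hΔ, htr⟩ := exists_model_of_leaves hcore hborel f hgen hBorel hDist hF2 hF3
  set 𝒟 := datum hunr hpol f hgen B F m hdist with h𝒟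
  have hsc : 𝒟.HasScalarCentralizer := fun M hM =>
    hasScalarCentralizer_of_isAbsIrreducible f B (hirr f B hgen) M hM
  have hda : ∀ v : HeightOneSpectrum (𝓞 K), ((3 : ℕ) : 𝓞 K) ∈ v.asIdeal → 𝒟.IsDistinguishedAt v := by
    intro v hv
    exact (hdist v (by simpa using hv)).2
  obtain ⟨𝓡'⟩ := hF1 ℚ K 3 3 (O₀ ι e) (ZMod 3) 𝒟 hsc hda
  let 𝓡 : UniversalRing f B F m (O₀ ι e) :=
    { R := 𝓡'.R
      π := 𝓡'.π
      π_surjective := 𝓡'.π_surjective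
      ρ := 𝓡'.ρ
      isTypeDelta := (isDeformation_datum_iff 𝓡'.π 𝓡'.ρ).mp 𝓡'.isDeformation
      universal := fun A _ _ _ _ _ πA hπA ρA hρA =>
        𝓡'.universal A πA hπA ρA ((isDeformation_datum_iff πA ρA).mpr hρA) }
  have hΔ' : 𝒟.IsDeformation (Algebra.ofId (O₀ ι e) (ZMod 3)) ρ₀ :=
    (isDeformation_datum_iff _ ρ₀).mpr hΔ
  obtain ⟨x, hx, -⟩ := 𝓡'.universal (O₀ ι e) (Algebra.ofId (O₀ ι e) (ZMod 3))
    (algebraMap_O₀_ZMod_surjective ι e) ρ₀ hΔ'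
  refine ⟨{ B := B, F := F, m := m, 𝒪 := O₀ ι e,
            residue_surjective := algebraMap_O₀_ZMod_surjective ι e
            j := j₀ ι e, j_injective := j₀_injective ι e, j_comp := j₀_comp_algebraMap ι e
            distinguished := hdist, 𝓡 := 𝓡, x := x, x_trace := ?_ }⟩
  intro 𝔭 h𝔭 𝔓 h𝔓 σ hσ
  obtain ⟨P, -, hP⟩ := hx
  have htrace : (ρ₀ σ).val.trace = x (𝓡'.ρ σ).val.trace := by
    rw [hP σ, MonoidHom.comp_apply, trace_conj_map]
    rfl
  rw [← htr 𝔭 h𝔭 𝔓 h𝔓 σ hσ, htrace]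

end

end Summit.Langlands.Langlands.Cruxes.MuOrdinaryFamilyRT.FreeSeedSmoothRt
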